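import Literature.Probability.LatticeModels.ProdBernoulliIndependence
import HarnessLib

/-!
# `NoHeavyLowerTail` (stmt-CriticalPhenomena-4575) — containment log-supermodularity of the miss probabilities of a hitting family ("FF" atom)

Support file, seat `prim-l12-p5` (gen 9), `--supports stmt-CriticalPhenomena-4575`.  Standard axioms, no definitions, no sorries.
For finite sets `A_j ⊆ ι` (`j < k`) and a product measure with silent probabilities `q_c = 1 − p_c ∈ [0,1]`, write `W(R) = ∏_{c ∈ ⋃_{j∈R} A_j} q_c`
= the probability that no `A_j`, `j ∈ R`, is hit (`prodBernoulli_real_forall_notMem`).  Then for all `R, R' ⊆ {0,…,k−1}`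
  `W(R) · W(R') ≤ W(R ∪ R') · W(R ∩ R')`   (`prod_biUnion_mul_le`, `miss_logSupermodular`):
`⋃_{R∪R'} = (⋃_R) ∪ (⋃_{R'})` and `⋃_{R∩R'} ⊆ (⋃_R) ∩ (⋃_{R'})`, so by `∏_{S∪T}∏_{S∩T} = ∏_S ∏_T` the two sides differ by the factors `q_c ≤ 1` of the coins
lying in `(⋃_R) ∩ (⋃_{R'})` but in no `A_j` with `j ∈ R ∩ R'`.  In pattern-law terms (`F(S) = P({j : ω ∈ H_{A_j}} ⊆ S) = W(Sᶜ)`) this is the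
CONTAINMENT LOG-SUPERMODULARITY `F(S∪S')F(S∩S') ≥ F(S)F(S')` — the "FF" atom of the census lane's exact coin-step certificates (ttrl2 cp-coin,
run/shared/lean/ttrl/coin/certs/cert_n5_T11100_a1_D5_linf_j105759.json), the only non-Sahi atom they use.  [this work; folklore]
-/

namespace Summit.CriticalPhenomena.PercolationContinuityZ3.Theorems

namespace SahiHitting

open Finset MeasureTheory Literature.Probability.LatticeModels

variable {ι : Type*} [DecidableEq ι]

/-- **Miss probabilities are containment-log-supermodular** (product form): for `q ∈ [0,1]^ι`,
`(∏_{⋃_R A} q)(∏_{⋃_{R'} A} q) ≤ (∏_{⋃_{R∪R'} A} q)(∏_{⋃_{R∩R'} A} q)`. [this work; folklore] -/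
theorem prod_biUnion_mul_le {k : ℕ} (A : Fin k → Finset ι) (q : ι → ℝ) (hq0 : ∀ c, 0 ≤ q c) (hq1 : ∀ c, q c ≤ 1)
    (R R' : Finset (Fin k)) :
    (∏ c ∈ R.biUnion A, q c) * (∏ c ∈ R'.biUnion A, q c)
      ≤ (∏ c ∈ (R ∪ R').biUnion A, q c) * (∏ c ∈ (R ∩ R').biUnion A, q c) := by
  have hU : (R ∪ R').biUnion A = R.biUnion A ∪ R'.biUnion A := by
    ext c; simp only [Finset.mem_biUnion, Finset.mem_union]
    constructor
    · rintro ⟨j, hj | hj, hc⟩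
      exacts [Or.inl ⟨j, hj, hc⟩, Or.inr ⟨j, hj, hc⟩]
    · rintro (⟨j, hj, hc⟩ | ⟨j, hj, hc⟩)
      exacts [⟨j, Or.inl hj, hc⟩, ⟨j, Or.inr hj, hc⟩]
  have hsub : (R ∩ R').biUnion A ⊆ R.biUnion A ∩ R'.biUnion A := by
    intro c hc
    obtain ⟨j, hj, hcj⟩ := Finset.mem_biUnion.1 hc
    rw [Finset.mem_inter] at hj ⊢
    exact ⟨Finset.mem_biUnion.2 ⟨j, hj.1, hcj⟩, Finset.mem_biUnion.2 ⟨j, hj.2, hcj⟩⟩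
  rw [← Finset.prod_union_inter, hU]
  refine mul_le_mul_of_nonneg_left ?_ (Finset.prod_nonneg fun c _ => hq0 c)
  -- ∏ over the larger set S ∩ T is ≤ ∏ over the subset
  rw [← Finset.prod_sdiff hsub]
  have h1 : ∏ c ∈ (R.biUnion A ∩ R'.biUnion A) \ (R ∩ R').biUnion A, q c ≤ 1 :=
    Finset.prod_le_one (fun c _ => hq0 c) (fun c _ => hq1 c)
  have h2 : 0 ≤ ∏ c ∈ (R ∩ R').biUnion A, q c := Finset.prod_nonneg fun c _ => hq0 c
  nlinarith

/-- **Event form**: with `W(R) = P(no A_j, j ∈ R, is hit)` under `prodBernoulli p`, `W(R)W(R') ≤ W(R∪R')W(R∩R')`. [this work; folklore] -/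
theorem miss_logSupermodular {k : ℕ} (p : ι → unitInterval) (A : Fin k → Finset ι) (R R' : Finset (Fin k)) :
    (prodBernoulli p).real {ω : Set ι | ∀ c ∈ R.biUnion A, c ∉ ω} * (prodBernoulli p).real {ω : Set ι | ∀ c ∈ R'.biUnion A, c ∉ ω}
      ≤ (prodBernoulli p).real {ω : Set ι | ∀ c ∈ (R ∪ R').biUnion A, c ∉ ω}
          * (prodBernoulli p).real {ω : Set ι | ∀ c ∈ (R ∩ R').biUnion A, c ∉ ω} := by
  simp only [prodBernoulli_real_forall_notMem]
  exact prod_biUnion_mul_le A (fun c => 1 - (p c : ℝ)) (fun c => sub_nonneg.2 (p c).2.2) (fun c => sub_le_self _ (p c).2.1) R R'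

end SahiHitting

end Summit.CriticalPhenomena.PercolationContinuityZ3.Theorems
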